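import Literature.NumberTheory.Rogawski1990.RankOneUnstableTransferRamifiedCoreOfPairs        -- ★ p843850 (this seat): `rankOneUnstable_core_of_signedPairs` (brings ★ fold p843587, ★ L2a-ram, ★ S3 ED. 2, ★ (b3))
import Literature.NumberTheory.Rogawski1990.RankOneUnstableRamifiedSignedPairsTorus          -- ★ F0P3-p01 (g14) (iii): `exists_signedPairs_of_ramified_tame` (brings ★ PAIR edge p843849 ∕ PAIR-modular, ★ cover, ★ pieces, ★ S2-ram, ★ seam p843904)
import Literature.NumberTheory.Rogawski1990.RankOneTorusEigenframeTransfer                   -- ★ A-p19 (g23) A-29 (a): `frameEntry_frame_of_eigenframe` (the frame ALONG `Z(t₀)` from the eigenframe at `t₀`)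
import Literature.NumberTheory.Rogawski1990.RankOneUnstableDeltaValueRamifiedTorus           -- ★ p843873 A-p19 (g23) R-4c⁺ ED. 2: `exists_rankOneDelta_mul_sign_eq_of_ramified_tame` (brings ★ R-0c p843642)
import Literature.NumberTheory.Automorphic.SelfDualStableLatticeDepthCountRamifiedCM         -- ★ p843782 A-p01 (g21) R2-E ED. 2: `exists_diagonal_unit_eigenframe_antidiagTwo_of_ramified`
import Literature.NumberTheory.Rogawski1990.RankOneUnstableRamifiedUnitSimilitude            -- ★ A-p19 (g22) R-0: `ramificationIdx'_ne_one_of_not_isUnramifiedIn`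
import Literature.NumberTheory.Rogawski1990.RankOneKappaOrbitalDepthExpansionH               -- ★ A-p13 (g32) S0: `coe_localNonsplitEquiv_mul_map_eq`
import Literature.NumberTheory.Automorphic.ValuedFieldValuativeRelBridge                     -- ★ `v_eq_one_iff_valuation_eq_one`, `v_le_one_iff_mem_integer`
import Literature.NumberTheory.Rogawski1990.RankOneUnstableTransferNonsplitCMERamifiedOfTame  -- ★ p843709 F0P3a-p08 (g15): `…CMERamified_of_core_tame_of_wild` (binder shape `hcore_tame`)
import Literature.NumberTheory.Rogawski1990.RankOneUnstableTransferNonsplitWild              -- ★ p843764 F0P3a-p08 (g15): the named WILD residue `RankOneUnstableTransferNonsplitCMERamifiedWild`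
import HarnessLib

/-!
# R-5b END — THE TAME-RAMIFIED CORE `rankOneUnstable_core_ramified_tame`, CLOSED, and the fold-in junction `…CMERamified_of_wild`
# (road «R1-ram» of «R1LL-tree»; Rogawski 1990 §4.9 Lemma 4.9.3 (4.9.2); Labesse–Langlands 1979 §2 Lemma 2.1; architect A-p16 RULINGS A-19∕A-21 (d)∕A-22∕A-25 (c)∕A-29)

Topic `NumberTheory/Rogawski1990`; namespace `Literature.NumberTheory.Rogawski1990`.  THEOREMS ONLY (no definition, no instance, no notation, no named fact, no `sorry`);
kernel lane `--supports stmt-HodgeConjecture-24833`.  Cell `pub/hodgecm-mathlib` (D-0151), crux H413 = `stmt-HodgeConjecture-24833`, line «N6nsGerm» stub `stub_N6nsR1LL`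
(pen F0P2-p02; junction ★ p843709 `rankOneUnstableTransferNonsplitCMERamified_of_core_tame_of_wild (hcore_tame) (hwild)`).  R-5b END assembler F0P3a-p03 (g12).
HONEST LABEL: HC_CM is proved only modulo the printed citations (2 remaining named inputs hLiu418 24832, h413 24833) until rung 0 closes; this file is the
composition of ★ theorems and asserts nothing printed; §2 is CONDITIONAL on the named wild residue (dyadic places), which stays a hypothesis.

§1 THE HEAD `rankOneUnstable_core_ramified_tame` — binders = ★ p843709's `hcore_tame` VERBATIM (`(L v) (hv) (hram) (h2 : ∀ w, |2|_w = 1) (μ) [..] (ν) [..] (hμu) (hμω) (f hf)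
(t₀ P d ht₀ hP hd1)`), conclusion `∃ fC, IsLocallyConstant fC ∧ ∀ t regular, ∀ t′ stably conjugate not conjugate, Δ(t)·(O_ν(↑t, f) − O_ν(t′, f)) = fC t`.
PROOF (one `obtain` chain, then ★ `rankOneUnstable_core_of_signedPairs`): the place `w` (one above `v`, `c • w = w`, `e(w|v) ≠ 1`, `|2|_w = 1`); the one-place model `E₂`;
the unit-similitude partner `e = Ad diag(1, r)` with its residue bit (★ R-0c `exists_unitSimilitudePartner_residueBit_of_ramified`: `σO`, `u`, `η`, `hconj`, `hest`, …);
the UNIT-GRAM EIGENFRAME `Q` of `E₂ t₀.1` (★ A-p01 `exists_diagonal_unit_eigenframe_antidiagTwo_of_ramified` at the frame `P_w`, eigenvalues `(d₀)_w ≠ (d₁)_w` of norm one),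
`θ₀ := h 0`; the torus `Δ`-law with its skew uniformiser `ϖE` and sign spec (★ A-p19 `exists_rankOneDelta_mul_sign_eq_of_ramified_tame` at `θ₀`); the SIGNED PAIRS on the torus
(★ F0P3-p01 (g14) `exists_signedPairs_of_ramified_tame`: pieces over the ramified vertex cover, common level, per-piece PAIR expansions with the bit sign law in the fold's
currency, `εD` with A-p19's spec); `q := #(𝓞_{L⁺}∕v)`, `s₀ := [res_w(−1)]` (architect pins P1–P3).
§2 `rankOneUnstableTransferNonsplitCMERamified_of_wild (hwild : RankOneUnstableTransferNonsplitCMERamifiedWild) : RankOneUnstableTransferNonsplitCMERamified`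
:= ★ p843709 at §1 — the pen's fold-in junction (option (A), F0P2-p02 (g10) 11:0xZ).

## References
* [Rogawski1990] J. D. Rogawski, *Automorphic Representations of Unitary Groups in Three Variables*, Ann. of Math. Stud. 123 (1990): §4.9 Lemma 4.9.3, (4.9.2) pp. 54–56; §3.6 pp. 31–32.
* [LabesseLanglands1979] J.-P. Labesse, R. P. Langlands, *L-indistinguishability for SL(2)*, Canad. J. Math. 31 (1979) 726–785: §2 Lemma 2.1 pp. 8–10.
* [Kottwitz1988] R. Kottwitz, *Tamagawa numbers*, Ann. of Math. 127 (1988): §2.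
-/

set_option autoImplicit false

noncomputable section

open Set Filter Topology MeasureTheory NumberField IsDedekindDomain Finset Matrix
open scoped Matrix MatrixGroups ValuativeRel

namespace Literature.NumberTheory.Rogawski1990

open Literature.NumberTheory.Automorphic Literature.NumberTheory.Automorphic.UnitaryGroup Literature.NumberTheory.GaloisRepresentations

section Head

variable (L : Type) [Field L] [NumberField L] [IsCMField L] (v : HeightOneSpectrum (𝓞 ↥(maximalRealSubfield L)))

/-- At a place with ONE place of `L` above it, that place is fixed by complex conjugation (local copy of ★ `smul_eq_of_subsingleton_placesOver`).
[cite: CasselsFrohlichANT1967, Ch. VII Prop. 1.2 (ii)] -/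
private theorem smul_eq_of_subsingleton_placesOver_END (hv : Subsingleton (PlacesOver L v)) (w : PlacesOver L v) : IsCMField.complexConj L • w.1 = w.1 := by
  have hmem : (IsCMField.complexConj L • w.1).under (𝓞 ↥(maximalRealSubfield L)) = v := by
    rw [HeightOneSpectrum.under_algEquiv_smul]; exact w.2
  exact congrArg Subtype.val (Subsingleton.elim (⟨IsCMField.complexConj L • w.1, hmem⟩ : PlacesOver L v) w)

/-- `![a, b]` is injective when `a ≠ b`. [cite: CasselsFrohlichANT1967, Ch. I §1] -/
private theorem injective_vecCons_two_END {Y : Type*} {a b : Y} (h : a ≠ b) : Function.Injective ![a, b] := by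
  intro i j hij
  fin_cases i <;> fin_cases j
  · rfl
  · exact absurd hij h
  · exact absurd hij.symm h
  · rfl

-- `L_w`-sized statement and a long composition: elaboration budget only (no search); `Classical` for the residue-square `ite`s (as ★ p843873)
set_option maxHeartbeats 1600000 in
open scoped Classical in
/-- **(R1-core) AT A TAMELY RAMIFIED PLACE — THE HEAD, CLOSED** (binders = ★ p843709 `hcore_tame` VERBATIM; see the module docstring for the `obtain` chain).
At a finite place `v` of `L⁺` with ONE place `w` of the CM field `L` above it, RAMIFIED and TAME (`|2|_w = 1`), for a Hecke character `μ` of `L` restricting to `ω_{L∕L⁺}`,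
a Haar measure `ν` on `H_v`, `f ∈ C_c^∞(H_v)` and an elliptic regular torus `Z(t₀)` framed by `P`: there is a LOCALLY CONSTANT `fC` on `Z(t₀)` with
`Δ(t)·(O_ν(↑t, f) − O_ν(t′, f)) = fC t` for `t` regular and `t′` stably conjugate, not conjugate to `↑t`.
[cite: Rogawski1990, §4.9 Lemma 4.9.3, (4.9.2) pp. 54–56; §3.6 pp. 31–32] [cite: LabesseLanglands1979, §2 Lemma 2.1 pp. 8–10] [cite: Kottwitz1988, §2] -/
theorem rankOneUnstable_core_ramified_tame (hv : Subsingleton (PlacesOver L v)) (hram : ¬ Algebra.IsUnramifiedIn (𝓞 L) v.asIdeal)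
    (h2 : ∀ w : PlacesOver L v, Valued.v (2 : w.1.adicCompletion L) = 1)
    (μ : HeckeCharacter L) [MeasurableSpace ((cmDatum L 2 (Matrix.of fun i j : Fin 2 => if i.val + j.val + 1 = 2 then (1 : L) else 0)).Local v × (cmDatum L 1 (Matrix.of fun i j : Fin 1 => if i.val + j.val + 1 = 1 then (1 : L) else 0)).Local v)] [BorelSpace ((cmDatum L 2 (Matrix.of fun i j : Fin 2 => if i.val + j.val + 1 = 2 then (1 : L) else 0)).Local v × (cmDatum L 1 (Matrix.of fun i j : Fin 1 => if i.val + j.val + 1 = 1 then (1 : L) else 0)).Local v)] (ν : Measure ((cmDatum L 2 (Matrix.of fun i j : Fin 2 => if i.val + j.val + 1 = 2 then (1 : L) else 0)).Local v × (cmDatum L 1 (Matrix.of fun i j : Fin 1 => if i.val + j.val + 1 = 1 then (1 : L) else 0)).Local v)) [ν.IsHaarMeasure] [ν.IsMulRightInvariant]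
    (hμu : μ.IsUnitary)
    (hμω : ∀ x : ideleGroup ↥(maximalRealSubfield L), μ (AdeleRing.ideleBaseChange (↥(maximalRealSubfield L)) L x) = quadraticHeckeCharCM L x)
    (f : ((cmDatum L 2 (Matrix.of fun i j : Fin 2 => if i.val + j.val + 1 = 2 then (1 : L) else 0)).Local v × (cmDatum L 1 (Matrix.of fun i j : Fin 1 => if i.val + j.val + 1 = 1 then (1 : L) else 0)).Local v) → ℂ) (hf : IsLocSmooth f)
    (t₀ : ((cmDatum L 2 (Matrix.of fun i j : Fin 2 => if i.val + j.val + 1 = 2 then (1 : L) else 0)).Local v × (cmDatum L 1 (Matrix.of fun i j : Fin 1 => if i.val + j.val + 1 = 1 then (1 : L) else 0)).Local v)) (P : GL (Fin 2) (LocalRing L v)) (d : Fin 2 → (LocalRing L v))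
    (ht₀ : IsRegularElt (t₀.1.val : GL (Fin 2) (LocalRing L v)))
    (hP : (t₀.1.val.val : Matrix (Fin 2) (Fin 2) (LocalRing L v)) * P.val = P.val * Matrix.diagonal d)
    (hd1 : ∀ i, conjLocal L (IsCMField.complexConj L) v (d i) * d i = 1) :
    ∃ fC : ↥(Subgroup.centralizer ({t₀} : Set ((cmDatum L 2 (Matrix.of fun i j : Fin 2 => if i.val + j.val + 1 = 2 then (1 : L) else 0)).Local v × (cmDatum L 1 (Matrix.of fun i j : Fin 1 => if i.val + j.val + 1 = 1 then (1 : L) else 0)).Local v))) → ℂ, IsLocallyConstant fC ∧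
      ∀ t : ↥(Subgroup.centralizer ({t₀} : Set ((cmDatum L 2 (Matrix.of fun i j : Fin 2 => if i.val + j.val + 1 = 2 then (1 : L) else 0)).Local v × (cmDatum L 1 (Matrix.of fun i j : Fin 1 => if i.val + j.val + 1 = 1 then (1 : L) else 0)).Local v))), IsRegularElt ((t : ((cmDatum L 2 (Matrix.of fun i j : Fin 2 => if i.val + j.val + 1 = 2 then (1 : L) else 0)).Local v × (cmDatum L 1 (Matrix.of fun i j : Fin 1 => if i.val + j.val + 1 = 1 then (1 : L) else 0)).Local v)).1.val : GL (Fin 2) (LocalRing L v)) → ∀ t' : ((cmDatum L 2 (Matrix.of fun i j : Fin 2 => if i.val + j.val + 1 = 2 then (1 : L) else 0)).Local v × (cmDatum L 1 (Matrix.of fun i j : Fin 1 => if i.val + j.val + 1 = 1 then (1 : L) else 0)).Local v),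
        IsLocalStablyConjH L v (t : ((cmDatum L 2 (Matrix.of fun i j : Fin 2 => if i.val + j.val + 1 = 2 then (1 : L) else 0)).Local v × (cmDatum L 1 (Matrix.of fun i j : Fin 1 => if i.val + j.val + 1 = 1 then (1 : L) else 0)).Local v)) t' → ¬ IsConj (t : ((cmDatum L 2 (Matrix.of fun i j : Fin 2 => if i.val + j.val + 1 = 2 then (1 : L) else 0)).Local v × (cmDatum L 1 (Matrix.of fun i j : Fin 1 => if i.val + j.val + 1 = 1 then (1 : L) else 0)).Local v)) t' →
        ((finHeckeValue L v μ (((P⁻¹).val * ((t : ((cmDatum L 2 (Matrix.of fun i j : Fin 2 => if i.val + j.val + 1 = 2 then (1 : L) else 0)).Local v × (cmDatum L 1 (Matrix.of fun i j : Fin 1 => if i.val + j.val + 1 = 1 then (1 : L) else 0)).Local v)).1.val.val : Matrix (Fin 2) (Fin 2) (LocalRing L v)) * P.val) 0 0 - ((P⁻¹).val * ((t : ((cmDatum L 2 (Matrix.of fun i j : Fin 2 => if i.val + j.val + 1 = 2 then (1 : L) else 0)).Local v × (cmDatum L 1 (Matrix.of fun i j : Fin 1 => if i.val + j.val + 1 =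 1 then (1 : L) else 0)).Local v)).1.val.val : Matrix (Fin 2) (Fin 2) (LocalRing L v)) * P.val) 1 1))⁻¹ : ℂ) * ((Real.sqrt (∏ w' : PlacesOver L v, ‖(((P⁻¹).val * ((t : ((cmDatum L 2 (Matrix.of fun i j : Fin 2 => if i.val + j.val + 1 = 2 then (1 : L) else 0)).Local v × (cmDatum L 1 (Matrix.of fun i j : Fin 1 => if i.val + j.val + 1 = 1 then (1 : L) else 0)).Local v)).1.val.val : Matrix (Fin 2) (Fin 2) (LocalRing L v)) * P.val) 0 0 - ((P⁻¹).val * ((t : ((cmDatum L 2 (Matrix.of fun i j : Fin 2 => if i.val + j.val + 1 = 2 then (1 : L) else 0)).Local v × (cmDatum L 1 (Matrix.of fun i j : Fin 1 => if i.val + j.val + 1 = 1 then (1 : L) else 0)).Local v)).1.val.val : Matrix (Fin 2) (Fin 2) (LocalRing L v)) * P.val) 1 1) w'‖) : ℝ) : ℂ) *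
          ((∫ y, f (y * (t : ((cmDatum L 2 (Matrix.of fun i j : Fin 2 => if i.val + j.val + 1 = 2 then (1 : L) else 0)).Local v × (cmDatum L 1 (Matrix.of fun i j : Fin 1 => if i.val + j.val + 1 = 1 then (1 : L) else 0)).Local v)) * y⁻¹) ∂ν) - ∫ y, f (y * t' * y⁻¹) ∂ν) = fC t := by
  classical
  have _hμu := hμu
  -- the place `w`: one above `v`, `c • w = w`, ramified, tame
  obtain ⟨w⟩ : Nonempty (PlacesOver L v) := inferInstance
  have hw : IsCMField.complexConj L • w.1 = w.1 := smul_eq_of_subsingleton_placesOver_END L v hv w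
  have he : v.asIdeal.ramificationIdx' w.1.asIdeal ≠ 1 := ramificationIdx'_ne_one_of_not_isUnramifiedIn L v hv hram w
  have h2w : Valued.v (2 : (w.1.adicCompletion L)) = 1 := h2 w
  -- the one-place model, re-typed on the `cmDatum` carrier
  obtain ⟨E₂, hE₂⟩ : ∃ E₂ : (cmDatum L 2 (Matrix.of fun i j : Fin 2 => if i.val + j.val + 1 = 2 then (1 : L) else 0)).Local v ≃ₜ* ↥(unitaryGroupOfForm (galAdicCompletionMap (L := L) (IsCMField.complexConj L) hw) (placeForm (Matrix.of fun i j : Fin 2 => if i.val + j.val + 1 = 2 then (1 : L) else 0) w.1)), ∀ g, ((E₂ g : ↥(unitaryGroupOfForm (galAdicCompletionMap (L := L) (IsCMField.complexConj L) hw) (placeForm (Matrix.of fun i j : Fin 2 => if i.val + j.val + 1 = 2 then (1 : L) else 0) w.1))) : GL (Fin 2) (w.1.adicCompletion L)) = (((localNonsplitEquiv (IsCMField.complexConj L) (Matrix.of fun i j : Fin 2 => if i.val + j.val + 1 = 2 then (1 : L) else 0) (IsCMField.complexConj_ne_one L) w hw) g : ↥(unitaryGroupOfForm (galAdicCompletionMap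 (L := L) (IsCMField.complexConj L) hw) (placeForm (Matrix.of fun i j : Fin 2 => if i.val + j.val + 1 = 2 then (1 : L) else 0) w.1))) : GL (Fin 2) (w.1.adicCompletion L)) := ⟨(localNonsplitEquiv (IsCMField.complexConj L) (Matrix.of fun i j : Fin 2 => if i.val + j.val + 1 = 2 then (1 : L) else 0) (IsCMField.complexConj_ne_one L) w hw), fun _ => rfl⟩
  -- ★ R-0c: `σ_w` on `𝒪_w`, the non-square unit `u = ↑η`, the unit-similitude partner `e` with its one-place conjugation law and `hest`
  obtain ⟨σO, rL, hru, u, η, e, hσO', hσσ, hres, h2O, hηu', hηu, hση, hη, hvu, hur, hAd, hframe, hest, hν, hK, hconj, hDint, hlev⟩ :=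
    UnitaryGroup.exists_unitSimilitudePartner_residueBit_of_ramified L v w hw he h2w t₀ P d ht₀ hP hd1
  have hconjE : ∀ a : ((cmDatum L 2 (Matrix.of fun i j : Fin 2 => if i.val + j.val + 1 = 2 then (1 : L) else 0)).Local v × (cmDatum L 1 (Matrix.of fun i j : Fin 1 => if i.val + j.val + 1 = 1 then (1 : L) else 0)).Local v), ((E₂ (e a).1 : ↥(unitaryGroupOfForm (galAdicCompletionMap (L := L) (IsCMField.complexConj L) hw) (placeForm (Matrix.of fun i j : Fin 2 => if i.val + j.val + 1 = 2 then (1 : L) else 0) w.1))) : GL (Fin 2) (w.1.adicCompletion L)) = (glDiagonal 2 (w.1.adicCompletion L) ![1, u]) * ((E₂ a.1 : ↥(unitaryGroupOfForm (galAdicCompletionMap (L := L) (IsCMField.complexConj L) hw) (placeForm (Matrix.of fun i j : Fin 2 => if i.val + j.val + 1 = 2 then (1 : L) else 0) w.1))) : GL (Fin 2) (w.1.adicCompletion L)) * (glDiagonal 2 (w.1.adicCompletion L) ![1, u])⁻¹ :=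
    fun a => by rw [hE₂, hE₂]; exact hconj a
  -- the frame of `γ := E₂ t₀.1` at `w`: `P_w`, eigenvalues `((d 0)_w, (d 1)_w)`, distinct, of norm one
  have ht₀Z : t₀ ∈ Subgroup.centralizer ({t₀} : Set ((cmDatum L 2 (Matrix.of fun i j : Fin 2 => if i.val + j.val + 1 = 2 then (1 : L) else 0)).Local v × (cmDatum L 1 (Matrix.of fun i j : Fin 1 => if i.val + j.val + 1 = 1 then (1 : L) else 0)).Local v)) := Subgroup.mem_centralizer_singleton_iff.2 rfl
  have hτd : ∀ i : Fin 2, ((P⁻¹).val * (((⟨t₀, ht₀Z⟩ : ↥(Subgroup.centralizer ({t₀} : Set ((cmDatum L 2 (Matrix.of fun i j : Fin 2 => if i.val + j.val + 1 = 2 then (1 : L) else 0)).Local v × (cmDatum L 1 (Matrix.of fun i j : Fin 1 => if i.val + j.val + 1 = 1 then (1 : L) else 0)).Local v)))) : ((cmDatum L 2 (Matrix.of fun i j : Fin 2 => if i.val + j.val + 1 = 2 then (1 : L) else 0)).Local v × (cmDatum L 1 (Matrix.of fun i j : Fin 1 => if i.val + j.val + 1 = 1 then (1 : L) else 0)).Local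 v)).1.val.val : Matrix (Fin 2) (Fin 2) (LocalRing L v)) * P.val) i i = d i := by
    intro i
    have h : (P⁻¹).val * (((⟨t₀, ht₀Z⟩ : ↥(Subgroup.centralizer ({t₀} : Set ((cmDatum L 2 (Matrix.of fun i j : Fin 2 => if i.val + j.val + 1 = 2 then (1 : L) else 0)).Local v × (cmDatum L 1 (Matrix.of fun i j : Fin 1 => if i.val + j.val + 1 = 1 then (1 : L) else 0)).Local v)))) : ((cmDatum L 2 (Matrix.of fun i j : Fin 2 => if i.val + j.val + 1 = 2 then (1 : L) else 0)).Local v × (cmDatum L 1 (Matrix.of fun i j : Fin 1 => if i.val + j.val + 1 = 1 then (1 : L) else 0)).Local v)).1.val.val : Matrix (Fin 2) (Fin 2) (LocalRing L v)) * P.val = Matrix.diagonal d := by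
      rw [Matrix.mul_assoc, show (((⟨t₀, ht₀Z⟩ : ↥(Subgroup.centralizer ({t₀} : Set ((cmDatum L 2 (Matrix.of fun i j : Fin 2 => if i.val + j.val + 1 = 2 then (1 : L) else 0)).Local v × (cmDatum L 1 (Matrix.of fun i j : Fin 1 => if i.val + j.val + 1 = 1 then (1 : L) else 0)).Local v)))) : ((cmDatum L 2 (Matrix.of fun i j : Fin 2 => if i.val + j.val + 1 = 2 then (1 : L) else 0)).Local v × (cmDatum L 1 (Matrix.of fun i j : Fin 1 => if i.val + j.val + 1 = 1 then (1 : L) else 0)).Local v)).1.val.val : Matrix (Fin 2) (Fin 2) (LocalRing L v)) = t₀.1.val.val from rfl, hP, ← Matrix.mul_assoc,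
        show (P⁻¹).val * P.val = 1 from P.inv_mul, Matrix.one_mul]
    rw [h, Matrix.diagonal_apply_eq]
  have hd01 : d 0 ≠ d 1 := by
    have h := (isRegularElt_iff_frameEntry_ne L v w hw t₀ P d ht₀ hP hd1 ⟨t₀, ht₀Z⟩).1 ht₀
    rwa [hτd 0, hτd 1] at h
  have hd01w : d 0 w ≠ d 1 w := fun h => hd01 ((LocalRing.eq_iff_apply_eq (IsCMField.complexConj L) (IsCMField.complexConj_ne_one L) w hw _ _).2 h)
  have hdw : Function.Injective ![d 0 w, d 1 w] := injective_vecCons_two_END hd01w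
  have hσw : ∀ x : LocalRing L v, conjLocal L (IsCMField.complexConj L) v x w = (galAdicCompletionMap (L := L) (IsCMField.complexConj L) hw) (x w) := fun x => conjLocal_apply_eq_galAdicCompletionMap L v w hw x
  have hd1w : ∀ i, (galAdicCompletionMap (L := L) (IsCMField.complexConj L) hw) (![d 0 w, d 1 w] i) * ![d 0 w, d 1 w] i = 1 := by
    intro i
    fin_cases i
    · have h := congrArg (fun x : LocalRing L v => x w) (hd1 0)
      simpa only [Fin.zero_eta, Fin.mk_one, Matrix.cons_val_zero, Matrix.cons_val_one, Matrix.head_cons, Pi.mul_apply, Pi.one_apply, hσw] using h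
    · have h := congrArg (fun x : LocalRing L v => x w) (hd1 1)
      simpa only [Fin.zero_eta, Fin.mk_one, Matrix.cons_val_zero, Matrix.cons_val_one, Matrix.head_cons, Pi.mul_apply, Pi.one_apply, hσw] using h
  have hPw : (((E₂ t₀.1 : ↥(unitaryGroupOfForm (galAdicCompletionMap (L := L) (IsCMField.complexConj L) hw) (placeForm (Matrix.of fun i j : Fin 2 => if i.val + j.val + 1 = 2 then (1 : L) else 0) w.1))) : GL (Fin 2) (w.1.adicCompletion L)) : Matrix (Fin 2) (Fin 2) (w.1.adicCompletion L)) * ((((Matrix.GeneralLinearGroup.map (Pi.evalRingHom (fun w' : PlacesOver L v => w'.1.adicCompletion L) w) P) : GL (Fin 2) (w.1.adicCompletion L)) : GL (Fin 2) (w.1.adicCompletion L)) : Matrix (Fin 2) (Fin 2) (w.1.adicCompletion L)) =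
      ((((Matrix.GeneralLinearGroup.map (Pi.evalRingHom (fun w' : PlacesOver L v => w'.1.adicCompletion L) w) P) : GL (Fin 2) (w.1.adicCompletion L)) : GL (Fin 2) (w.1.adicCompletion L)) : Matrix (Fin 2) (Fin 2) (w.1.adicCompletion L)) * diagonal ![d 0 w, d 1 w] := by
    have h := coe_localNonsplitEquiv_mul_map_eq L v w hw t₀.1 P (Matrix.diagonal d) hP
    rw [hE₂, h, Matrix.diagonal_map (map_zero _)]
    congr 1
    funext i
    fin_cases i <;> rfl
  -- ★ A-p01: the UNIT-GRAM EIGENFRAME `Q` of `E₂ t₀.1` (`γ Q = Q diag((d 0)_w, (d 1)_w)`, `ᵗσQ (Φ₂)_w Q = diag h`, `|hᵢ| = 1`, `σ hᵢ = hᵢ`, `h₀ r = −h₁`, `r̄` square)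
  obtain ⟨Q, h, rQ, hQ₀, hhv, hσh, hQh, hr, hsq⟩ :=
    exists_diagonal_unit_eigenframe_antidiagTwo_of_ramified L v w hw he h2w σO hσO' hres (E₂ t₀.1).2 hPw hdw hd1w
  have hh : ∀ i, Valued.v (h i) = 1 := fun i => (v_eq_one_iff_valuation_eq_one (h i)).2 (hhv i)
  -- `θ₀ := h 0 ∈ 𝒪_wˣ`
  have hθ₀ : IsUnit (⟨h 0, (v_le_one_iff_mem_integer (h 0)).1 (hh 0).le⟩ : 𝒪[(w.1.adicCompletion L)]) := isUnit_integer_of_v_eq_one w.1 (hh 0)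
  -- ★ A-p19 R-4c⁺ ED. 2: the skew uniformiser `ϖE`, the level `N₁`, the constant `E₀ ≠ 0`, and the `Δ`-law for every `εD` with the residue spec at `θ₀`
  obtain ⟨ϖE, N₁, E₀, hϖE, hσϖE, _hE₀, hΔlaw⟩ :=
    exists_rankOneDelta_mul_sign_eq_of_ramified_tame L v w hw he h2w μ hμω ⟨h 0, (v_le_one_iff_mem_integer (h 0)).1 (hh 0).le⟩ hθ₀ t₀ P d ht₀ hP hd1
  -- `σ_w u = u` (`u = ↑η`, `σO η = η`)
  have hσu : (galAdicCompletionMap (L := L) (IsCMField.complexConj L) hw) (u : (w.1.adicCompletion L)) = u := by rw [← hηu', ← hσO', hση]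
  -- ★ A-p19 A-29 (a): `Q` frames the WHOLE torus (`E₂ (↑t).1 · Q = Q · diag((τ₀ t)_w, (τ₁ t)_w)` for every `t ∈ Z(t₀)`)
  have hQ := frameEntry_frame_of_eigenframe L v w hw t₀ P d ht₀ hP hd1 E₂ hE₂ Q hQ₀
  -- ★ F0P3-p01 (iii) «PAIRS ON THE TORUS»: pieces, common window, value families, bookkeeping, depth parity, `εD` with its residue spec, and the per-piece PAIRS
  obtain ⟨n, φk, m, Xm, M, X, par, σ, r, A, c, εD, hφk, hsum, hψ, hX, hc, hc', hNodd, hεD, hpair⟩ :=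
    exists_signedPairs_of_ramified_tame L v w hw ν f hf t₀ P d ht₀ hP hd1 he h2w ϖE hϖE hσϖE σO hσO' hσσ hres u hvu hσu hηu' hηu hση hη E₂ hE₂ e (fun a => (hAd a).2) hconjE
      (fun t ht => (hest t ht).1) Q hQ hQh hh hσh rQ hr hsq
  -- `q = #(𝓞_{L⁺}∕v) ≠ 0`, `s₀ q ≠ 0`
  have hq : (((Nat.card (𝓞 ↥(maximalRealSubfield L) ⧸ v.asIdeal)) : ℕ) : ℂ) ≠ 0 := Nat.cast_ne_zero.2 (Nat.card_pos (α := 𝓞 ↥(maximalRealSubfield L) ⧸ v.asIdeal)).ne'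
  have hs0 : (if IsSquare (IsLocalRing.residue 𝒪[(w.1.adicCompletion L)] (-1)) then (1 : ℂ) else -1) * (((Nat.card (𝓞 ↥(maximalRealSubfield L) ⧸ v.asIdeal)) : ℕ) : ℂ) ≠ 0 := mul_ne_zero (by split_ifs <;> norm_num) hq
  exact rankOneUnstable_core_of_signedPairs L v hv w hw μ ν f hf t₀ P d ht₀ hP hd1 e hest φk hφk hsum E₂ (ϖE : (w.1.adicCompletion L)) ϖE.ne_zero m hψ Xm M X hX (Nat.card (𝓞 ↥(maximalRealSubfield L) ⧸ v.asIdeal)) hq (if IsSquare (IsLocalRing.residue 𝒪[(w.1.adicCompletion L)] (-1)) then (1 : ℂ) else -1) hs0 εD par σ r A c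
    hc hc' hNodd hpair N₁ E₀ (hΔlaw εD hεD)

end Head

/-! ## §2 The fold-in junction for the pen: `…CMERamified` from §1 and the named WILD residue -/

/-- **«R1-RAM-FOLD» AT THE CLOSED TAME CORE**: the ramified residue `RankOneUnstableTransferNonsplitCMERamified` follows from the named WILD (dyadic) residue alone,
the tame-ramified core being §1 — ★ p843709 `rankOneUnstableTransferNonsplitCMERamified_of_core_tame_of_wild rankOneUnstable_core_ramified_tame`.  CONDITIONAL on
`RankOneUnstableTransferNonsplitCMERamifiedWild` (a hypothesis, not asserted). [cite: Rogawski1990, §4.9 Lemma 4.9.3 (4.9.2) p. 56] [cite: LabesseLanglands1979, §2] -/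
theorem rankOneUnstableTransferNonsplitCMERamified_of_wild (hwild : RankOneUnstableTransferNonsplitCMERamifiedWild) : RankOneUnstableTransferNonsplitCMERamified :=
  rankOneUnstableTransferNonsplitCMERamified_of_core_tame_of_wild rankOneUnstable_core_ramified_tame hwild

end Literature.NumberTheory.Rogawski1990

end
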